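import Mathlib
import HarnessLib

/-!
# The EXACT launch threshold of the wide-steered walker family: `√2·(17 − √35)/36 = cos(π/4 + arccos(17/18)) ≈ 0.43541`
# (lane T crux `TextureLiminfV5`, stmt-Ventures-23912, sub-crux EDGE-ON `stub_edgeOn(S)`; cf-p1 (cxxxvii)(b) «SteepPlateAt»; 19480-p2 g12)

HONEST FRAMING. Venture `Summits/Ventures/Crystal3D` (cell `crystal3d-full`), route `route-Ventures-StickyWulffConstant`, helper `--supports` the
law-v5 crux `TextureLiminfV5` (stmt-Ventures-23912).  Elementary Euclidean geometry, standard axioms; no wall statement is touched; F-C1 not moved.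

THE POINT.  Every steered certificate (`BarlowUp/DownCertifiedSteerWide`, `BarlowTwoSidedCertifiedSteerWide`) launches a plate's walker family from an
up-slot `v` that is steep FOR THE STEERING: a unit `z` with `‖z − e‖ ≤ 1/3` (`e = ±e₃`) and `⟪L v, z⟫ ≥ √2/2`.  The engine and the sizing memos
(EPSILON-SIZING, 19480-p1's K-tables) use the numerical rule «such a `z` exists iff the slot's `e`-rise is `≥ 0.4354`».  This file makes the rule a
theorem with the exact constant, for unit vectors `u` (`= L v`) and `e`:
* `exists_wideSteer_of_rise_ge` — if `⟪u, e⟫ ≥ √2(17 − √35)/36` then some unit `z` with `‖z − e‖ ≤ 1/3` has `⟪u, z⟫ ≥ √2/2` (rotate `e` toward `u` by the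
  full chord angle `arccos(17/18)`, or take `z = e`);
* `inner_lt_of_rise_lt` — if `⟪u, e⟫ < √2(17 − √35)/36` then EVERY unit `z` with `‖z − e‖ ≤ 1/3` has `⟪u, z⟫ < √2/2`;
* **`wideSteerable_iff`** — the equivalence.
So (cxxxvii)(b)'s corner predicate «no up-slot of the presented plate has `e₃`-rise ≥ √2(17−√35)/36» is EXACTLY «no wide-steered family launches on that
plate» — menu-free, and independent of which finite steering menu an engine uses (a finite menu can only certify less).
WHAT THIS IS NOT: not a certificate, not a wall lemma; the ∇-capper rise clause, (γ₂) and the frame clauses (i)/(ii)/(iii)_z of the certificates are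
separate tests; F-C1 not moved.
-/

noncomputable section

namespace Summit.Ventures.Crystal3D.Theorems

open Real
open scoped InnerProductSpace

/-! ## The two constants: `cos β = 17/18`, `sin β = √35/18` (`β = arccos(17/18)`, the chord-`1/3` angle) and `cos(π/4 + β) = √2(17 − √35)/36` -/

/-- `sin (arccos (17/18)) = √35/18`. -/
theorem sin_arccos_seventeen_eighteenths : Real.sin (Real.arccos (17 / 18)) = Real.sqrt 35 / 18 := by
  rw [Real.sin_arccos]
  have h1 : (1 : ℝ) - (17 / 18) ^ 2 = 35 / 324 := by norm_num
  rw [h1, Real.sqrt_div (by norm_num : (0 : ℝ) ≤ 35)]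
  have h2 : Real.sqrt 324 = 18 := by
    rw [show (324 : ℝ) = 18 * 18 by norm_num, Real.sqrt_mul_self (by norm_num)]
  rw [h2]

/-- `arccos (17/18) ≤ π/4` (indeed `17/18 ≥ √2/2`). -/
theorem arccos_seventeen_eighteenths_le : Real.arccos (17 / 18) ≤ π / 4 := by
  have hs : Real.sqrt 2 / 2 ≤ 17 / 18 := by
    have h2 : Real.sqrt 2 ≤ 17 / 9 := by
      rw [show (17 : ℝ) / 9 = Real.sqrt ((17 / 9) ^ 2) by rw [Real.sqrt_sq (by norm_num)]]
      exact Real.sqrt_le_sqrt (by norm_num)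
    linarith
  have h := Real.arccos_le_arccos hs
  rwa [← Real.cos_pi_div_four, Real.arccos_cos (by positivity) (by linarith [Real.pi_pos])] at h

/-- **The threshold is a cosine**: `cos (π/4 + arccos (17/18)) = √2·(17 − √35)/36`. -/
theorem cos_pi_div_four_add_arccos : Real.cos (π / 4 + Real.arccos (17 / 18)) = Real.sqrt 2 * (17 - Real.sqrt 35) / 36 := by
  rw [Real.cos_add, Real.cos_pi_div_four, Real.sin_pi_div_four, Real.cos_arccos (by norm_num) (by norm_num),
    sin_arccos_seventeen_eighteenths]
  ring

/-- `arccos (√2·(17 − √35)/36) = π/4 + arccos (17/18)`. -/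
theorem arccos_threshold : Real.arccos (Real.sqrt 2 * (17 - Real.sqrt 35) / 36) = π / 4 + Real.arccos (17 / 18) := by
  rw [← cos_pi_div_four_add_arccos,
    Real.arccos_cos (by linarith [Real.arccos_nonneg (17 / 18 : ℝ), Real.pi_pos])
      (by linarith [arccos_seventeen_eighteenths_le, Real.pi_pos])]

/-- The threshold lies in `(0, √2/2)` (so in `[-1, 1]`). -/
theorem threshold_bounds : 0 < Real.sqrt 2 * (17 - Real.sqrt 35) / 36 ∧ Real.sqrt 2 * (17 - Real.sqrt 35) / 36 < Real.sqrt 2 / 2 := by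
  have h35 : Real.sqrt 35 < 6 := by
    rw [show (6 : ℝ) = Real.sqrt (6 ^ 2) by rw [Real.sqrt_sq (by norm_num)]]
    exact Real.sqrt_lt_sqrt (by norm_num) (by norm_num)
  have h35' : 0 ≤ Real.sqrt 35 := Real.sqrt_nonneg _
  have h2 : 0 < Real.sqrt 2 := Real.sqrt_pos.2 (by norm_num)
  constructor
  · have : 0 < 17 - Real.sqrt 35 := by linarith
    positivity
  · have : Real.sqrt 2 * (17 - Real.sqrt 35) / 36 = Real.sqrt 2 / 2 * ((17 - Real.sqrt 35) / 18) := by ring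
    rw [this]
    have h3 : (17 - Real.sqrt 35) / 18 < 1 := by linarith
    have h4 : 0 < Real.sqrt 2 / 2 := by positivity
    nlinarith

/-! ## Elementary inner-product bookkeeping for unit vectors -/

section
variable {u e : EuclideanSpace ℝ (Fin 3)}

/-- For unit `u`, `e` and `c = ⟪u, e⟫`: `⟪e, u − c•e⟫ = 0`. -/
theorem inner_orth_component_eq_zero (he : ‖e‖ = 1) : ⟪e, u - ⟪u, e⟫_ℝ • e⟫_ℝ = 0 := by
  rw [inner_sub_right, real_inner_smul_right, real_inner_self_eq_norm_sq, he, real_inner_comm]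
  ring

/-- For unit `u`, `e` and `c = ⟪u, e⟫`: `‖u − c•e‖² = 1 − c²`. -/
theorem norm_sq_orth_component (hu : ‖u‖ = 1) (he : ‖e‖ = 1) : ‖u - ⟪u, e⟫_ℝ • e‖ ^ 2 = 1 - ⟪u, e⟫_ℝ ^ 2 := by
  rw [← real_inner_self_eq_norm_sq, inner_sub_left, inner_sub_right, inner_sub_right, real_inner_smul_left, real_inner_smul_left,
    real_inner_smul_right, real_inner_smul_right, real_inner_self_eq_norm_sq, real_inner_self_eq_norm_sq, hu, he, real_inner_comm e u]
  ring

/-- For unit `u` and `c = ⟪u, e⟫`: `⟪u, u − c•e⟫ = 1 − c²`. -/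
theorem inner_self_orth_component (hu : ‖u‖ = 1) : ⟪u, u - ⟪u, e⟫_ℝ • e⟫_ℝ = 1 - ⟪u, e⟫_ℝ ^ 2 := by
  rw [inner_sub_right, real_inner_smul_right, real_inner_self_eq_norm_sq, hu]
  ring

/-- `‖a•e + b•w‖² = a² + b²` for orthogonal unit vectors `e`, `w`. -/
theorem norm_sq_combo {w : EuclideanSpace ℝ (Fin 3)} (he : ‖e‖ = 1) (hw : ‖w‖ = 1) (hew : ⟪e, w⟫_ℝ = 0) (a b : ℝ) :
    ‖a • e + b • w‖ ^ 2 = a ^ 2 + b ^ 2 := by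
  rw [norm_add_sq_real, norm_smul, norm_smul, he, hw, real_inner_smul_left, real_inner_smul_right, hew, Real.norm_eq_abs,
    Real.norm_eq_abs, mul_one, mul_one, sq_abs, sq_abs]
  ring

/-- `⟪x, a•e + b•w⟫ = a⟪x, e⟫ + b⟪x, w⟫`. -/
theorem inner_combo_right (x w : EuclideanSpace ℝ (Fin 3)) (a b : ℝ) :
    ⟪x, a • e + b • w⟫_ℝ = a * ⟪x, e⟫_ℝ + b * ⟪x, w⟫_ℝ := by
  rw [inner_add_right, real_inner_smul_right, real_inner_smul_right]

/-- `|⟪u, e⟫| ≤ 1` for unit vectors. -/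
theorem abs_inner_le_one (hu : ‖u‖ = 1) (he : ‖e‖ = 1) : |⟪u, e⟫_ℝ| ≤ 1 := by
  have h := abs_real_inner_le_norm u e
  rw [hu, he, one_mul] at h
  exact h

end

/-! ## Launchable: a steering exists above the threshold -/

/-- **A wide steering exists when the slot's `e`-rise is at least `√2(17 − √35)/36`.**  For unit `u`, `e` with `⟪u, e⟫ ≥ √2(17−√35)/36` there is a unit
`z` with `‖z − e‖ ≤ 1/3` and `⟪u, z⟫ ≥ √2/2` (if `⟪u, e⟫ ≥ √2/2` take `z = e`; otherwise rotate `e` toward `u` by `β = arccos(17/18)`: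
`z = (17/18)e + (√35/18)ŵ`, `ŵ` the unit in-plane component of `u`, and `⟪u, z⟫ = cos(arccos⟪u,e⟫ − β) ≥ cos(π/4)`). -/
theorem exists_wideSteer_of_rise_ge {u e : EuclideanSpace ℝ (Fin 3)} (hu : ‖u‖ = 1) (he : ‖e‖ = 1)
    (hc : Real.sqrt 2 * (17 - Real.sqrt 35) / 36 ≤ ⟪u, e⟫_ℝ) :
    ∃ z : EuclideanSpace ℝ (Fin 3), ‖z‖ = 1 ∧ ‖z - e‖ ≤ 1 / 3 ∧ Real.sqrt 2 / 2 ≤ ⟪u, z⟫_ℝ := by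
  by_cases hbig' : Real.sqrt 2 / 2 ≤ ⟪u, e⟫_ℝ
  · exact ⟨e, he, by simp, hbig'⟩
  have hbig : ⟪u, e⟫_ℝ < Real.sqrt 2 / 2 := lt_of_not_ge hbig'
  obtain ⟨hth0, hth1⟩ := threshold_bounds
  set c : ℝ := ⟪u, e⟫_ℝ with hc_def
  have hc0 : 0 < c := lt_of_lt_of_le hth0 hc
  have hs2 : Real.sqrt 2 / 2 < 1 := by
    have : Real.sqrt 2 < 2 := by
      rw [show (2 : ℝ) = Real.sqrt (2 ^ 2) by rw [Real.sqrt_sq (by norm_num)]]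
      exact Real.sqrt_lt_sqrt (by norm_num) (by norm_num)
    linarith
  have hc1 : c < 1 := hbig.trans hs2
  have h1c : 0 < 1 - c ^ 2 := by nlinarith
  -- the in-plane unit vector
  set w : EuclideanSpace ℝ (Fin 3) := u - c • e with hw
  have hew : ⟪e, w⟫_ℝ = 0 := by rw [hw, hc_def]; exact inner_orth_component_eq_zero he
  have hw2 : ‖w‖ ^ 2 = 1 - c ^ 2 := by rw [hw, hc_def]; exact norm_sq_orth_component hu he
  have huw : ⟪u, w⟫_ℝ = 1 - c ^ 2 := by rw [hw, hc_def]; exact inner_self_orth_component hu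
  have hwpos : 0 < ‖w‖ := by
    rcases (norm_nonneg w).eq_or_lt with h | h
    · rw [← h] at hw2; norm_num at hw2; linarith
    · exact h
  have hwn : ‖w‖ = Real.sqrt (1 - c ^ 2) := by
    rw [← hw2, Real.sqrt_sq (norm_nonneg _)]
  set wh : EuclideanSpace ℝ (Fin 3) := ‖w‖⁻¹ • w with hwh
  have hwh1 : ‖wh‖ = 1 := by
    rw [hwh, norm_smul, Real.norm_eq_abs, abs_inv, abs_of_pos hwpos, inv_mul_cancel₀ hwpos.ne']
  have hewh : ⟪e, wh⟫_ℝ = 0 := by rw [hwh, real_inner_smul_right, hew, mul_zero]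
  have hwhe : ⟪wh, e⟫_ℝ = 0 := by rw [real_inner_comm]; exact hewh
  have huwh : ⟪u, wh⟫_ℝ = ‖w‖ := by
    rw [hwh, real_inner_smul_right, huw, ← hw2, pow_two, ← mul_assoc, inv_mul_cancel₀ hwpos.ne', one_mul]
  -- the steering
  set z : EuclideanSpace ℝ (Fin 3) := (17 / 18 : ℝ) • e + (Real.sqrt 35 / 18) • wh with hz
  have h35 : Real.sqrt 35 ^ 2 = 35 := Real.sq_sqrt (by norm_num)
  have hz2 : ‖z‖ ^ 2 = 1 := by
    rw [hz, norm_sq_combo he hwh1 hewh]; nlinarith [h35]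
  have hz1 : ‖z‖ = 1 := by
    have hn := norm_nonneg z
    nlinarith
  have hzinner : ⟪z, e⟫_ℝ = 17 / 18 := by
    rw [hz, inner_add_left, real_inner_smul_left, real_inner_smul_left, real_inner_self_eq_norm_sq, he, hwhe]; ring
  have hze : ‖z - e‖ ≤ 1 / 3 := by
    have h : ‖z - e‖ ^ 2 = 1 / 9 := by
      rw [norm_sub_sq_real, hz2, hzinner, he]; norm_num
    have hn := norm_nonneg (z - e)
    nlinarith
  refine ⟨z, hz1, hze, ?_⟩
  -- `⟪u, z⟫ = cos(θ − β)` with `θ = arccos c`, `β = arccos(17/18)`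
  have huz : ⟪u, z⟫_ℝ = 17 / 18 * c + Real.sqrt 35 / 18 * Real.sqrt (1 - c ^ 2) := by
    rw [hz, inner_combo_right, ← hc_def, huwh, hwn]
  set θ : ℝ := Real.arccos c with hθ
  set β : ℝ := Real.arccos (17 / 18) with hβ
  have hcosθ : Real.cos θ = c := Real.cos_arccos (by linarith) hc1.le
  have hsinθ : Real.sin θ = Real.sqrt (1 - c ^ 2) := Real.sin_arccos c
  have hcosβ : Real.cos β = 17 / 18 := Real.cos_arccos (by norm_num) (by norm_num)
  have hsinβ : Real.sin β = Real.sqrt 35 / 18 := sin_arccos_seventeen_eighteenths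
  have hcs : ⟪u, z⟫_ℝ = Real.cos (θ - β) := by
    rw [Real.cos_sub, hcosθ, hsinθ, hcosβ, hsinβ, huz]; ring
  rw [hcs, ← Real.cos_pi_div_four]
  -- angles: `β ≤ π/4 ≤ θ ≤ π/4 + β`
  have hβle : β ≤ π / 4 := arccos_seventeen_eighteenths_le
  have hθge : π / 4 ≤ θ := by
    -- `arccos (√2/2) = π/4` (also `Literature.Probability.RandomPlanarGeometry.arccos_sqrt_two_div_two`)
    have h := Real.arccos_le_arccos hbig.le
    rwa [← Real.cos_pi_div_four, Real.arccos_cos (by positivity) (by linarith [Real.pi_pos])] at h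
  have hθle : θ ≤ π / 4 + β := by
    rw [hθ, hβ, ← arccos_threshold]; exact Real.arccos_le_arccos hc
  exact Real.cos_le_cos_of_nonneg_of_le_pi (by linarith) (by linarith [Real.pi_pos]) (by linarith)

/-! ## Not launchable: no steering below the threshold -/

/-- **No wide steering exists when the slot's `e`-rise is below `√2(17 − √35)/36`.**  For unit `u`, `e`, `z` with `‖z − e‖ ≤ 1/3` and
`⟪u, e⟫ < √2(17−√35)/36`: `⟪u, z⟫ < √2/2` (`⟪u, z⟫ ≤ cos(arccos⟪u,e⟫ − arccos⟪z,e⟫)`, and `arccos⟪u,e⟫ − arccos⟪z,e⟫ > (π/4 + β) − β`). -/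
theorem inner_lt_of_rise_lt {u e z : EuclideanSpace ℝ (Fin 3)} (hu : ‖u‖ = 1) (he : ‖e‖ = 1) (hz : ‖z‖ = 1) (hze : ‖z - e‖ ≤ 1 / 3)
    (hc : ⟪u, e⟫_ℝ < Real.sqrt 2 * (17 - Real.sqrt 35) / 36) : ⟪u, z⟫_ℝ < Real.sqrt 2 / 2 := by
  obtain ⟨hth0, hth1⟩ := threshold_bounds
  set c : ℝ := ⟪u, e⟫_ℝ with hc_def
  set d : ℝ := ⟪z, e⟫_ℝ with hd_def
  have hcm1 : -1 ≤ c := by have := abs_inner_le_one hu he; rw [abs_le] at this; exact this.1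
  have hc1 : c ≤ 1 := by have := abs_inner_le_one hu he; rw [abs_le] at this; exact this.2
  have hd1 : d ≤ 1 := by have := abs_inner_le_one hz he; rw [abs_le] at this; exact this.2
  have hs2 : Real.sqrt 2 / 2 < 1 := by
    have : Real.sqrt 2 < 2 := by
      rw [show (2 : ℝ) = Real.sqrt (2 ^ 2) by rw [Real.sqrt_sq (by norm_num)]]
      exact Real.sqrt_lt_sqrt (by norm_num) (by norm_num)
    linarith
  -- `‖z − e‖² = 2 − 2d ≤ 1/9`
  have hd : 17 / 18 ≤ d := by
    have h1 : ‖z - e‖ ^ 2 = 2 - 2 * d := by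
      rw [norm_sub_sq_real, hz, he, ← hd_def]; ring
    have h2 : ‖z - e‖ ^ 2 ≤ (1 / 3) ^ 2 := pow_le_pow_left₀ (norm_nonneg _) hze 2
    nlinarith
  -- orthogonal components
  set w : EuclideanSpace ℝ (Fin 3) := u - c • e with hw
  set p : EuclideanSpace ℝ (Fin 3) := z - d • e with hp
  have hep : ⟪e, p⟫_ℝ = 0 := by rw [hp, hd_def]; exact inner_orth_component_eq_zero he
  have hw2 : ‖w‖ ^ 2 = 1 - c ^ 2 := by rw [hw, hc_def]; exact norm_sq_orth_component hu he
  have hp2 : ‖p‖ ^ 2 = 1 - d ^ 2 := by rw [hp, hd_def]; exact norm_sq_orth_component hz he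
  have hwn : ‖w‖ = Real.sqrt (1 - c ^ 2) := by rw [← hw2, Real.sqrt_sq (norm_nonneg _)]
  have hpn : ‖p‖ = Real.sqrt (1 - d ^ 2) := by rw [← hp2, Real.sqrt_sq (norm_nonneg _)]
  -- `⟪u, z⟫ = c·d + ⟪w, p⟫ ≤ c·d + ‖w‖‖p‖`
  have hz_dec : z = d • e + p := by rw [hp]; abel
  have hu_dec : u = c • e + w := by rw [hw]; abel
  have huz : ⟪u, z⟫_ℝ = c * d + ⟪w, p⟫_ℝ := by
    have h1 : ⟪u, z⟫_ℝ = d * ⟪u, e⟫_ℝ + ⟪u, p⟫_ℝ := by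
      conv_lhs => rw [hz_dec]
      rw [inner_add_right, real_inner_smul_right]
    have h2 : ⟪u, p⟫_ℝ = c * ⟪e, p⟫_ℝ + ⟪w, p⟫_ℝ := by
      conv_lhs => rw [hu_dec]
      rw [inner_add_left, real_inner_smul_left]
    rw [h1, h2, hep, ← hc_def]; ring
  have hle : ⟪u, z⟫_ℝ ≤ c * d + Real.sqrt (1 - c ^ 2) * Real.sqrt (1 - d ^ 2) := by
    rw [huz, ← hwn, ← hpn]; linarith [real_inner_le_norm w p]
  -- `= cos(θ − γ)` with `θ = arccos c > π/4 + β`, `γ = arccos d ≤ β`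
  set θ : ℝ := Real.arccos c with hθ
  set γ : ℝ := Real.arccos d with hγ
  set β : ℝ := Real.arccos (17 / 18) with hβ
  have hcosθ : Real.cos θ = c := Real.cos_arccos hcm1 hc1
  have hsinθ : Real.sin θ = Real.sqrt (1 - c ^ 2) := Real.sin_arccos c
  have hcosγ : Real.cos γ = d := Real.cos_arccos (by linarith) hd1
  have hsinγ : Real.sin γ = Real.sqrt (1 - d ^ 2) := Real.sin_arccos d
  have hcs : c * d + Real.sqrt (1 - c ^ 2) * Real.sqrt (1 - d ^ 2) = Real.cos (θ - γ) := by
    rw [Real.cos_sub, hcosθ, hsinθ, hcosγ, hsinγ]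
  have hθgt : π / 4 + β < θ := by
    rw [hθ, hβ, ← arccos_threshold]
    exact Real.arccos_lt_arccos hcm1 hc (by linarith)
  have hγle : γ ≤ β := by rw [hγ, hβ]; exact Real.arccos_le_arccos hd
  have hγ0 : 0 ≤ γ := Real.arccos_nonneg d
  have hθπ : θ ≤ π := Real.arccos_le_pi c
  have hlt : Real.cos (θ - γ) < Real.cos (π / 4) :=
    Real.cos_lt_cos_of_nonneg_of_le_pi (by positivity) (by linarith) (by linarith)
  rw [Real.cos_pi_div_four] at hlt
  linarith

/-! ## The equivalence -/

/-- **THE EXACT LAUNCH THRESHOLD.**  For unit vectors `u` (a slot direction `L v`) and `e` (`±e₃`): a unit steering `z` within chord `1/3` of `e` that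
is steep for the slot (`⟪u, z⟫ ≥ √2/2`) exists iff the slot's `e`-rise is at least `√2·(17 − √35)/36 = cos(π/4 + arccos(17/18)) ≈ 0.43541`. -/
theorem wideSteerable_iff {u e : EuclideanSpace ℝ (Fin 3)} (hu : ‖u‖ = 1) (he : ‖e‖ = 1) :
    (∃ z : EuclideanSpace ℝ (Fin 3), ‖z‖ = 1 ∧ ‖z - e‖ ≤ 1 / 3 ∧ Real.sqrt 2 / 2 ≤ ⟪u, z⟫_ℝ) ↔
      Real.sqrt 2 * (17 - Real.sqrt 35) / 36 ≤ ⟪u, e⟫_ℝ := by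
  constructor
  · rintro ⟨z, hz, hze, hsteep⟩
    rcases lt_or_ge ⟪u, e⟫_ℝ (Real.sqrt 2 * (17 - Real.sqrt 35) / 36) with hlt | hge
    · exact absurd hsteep (not_le.2 (inner_lt_of_rise_lt hu he hz hze hlt))
    · exact hge
  · exact exists_wideSteer_of_rise_ge hu he

/-- **Contrapositive for certificates**: a slot that IS steep for some admissible steering has `e`-rise `≥ √2(17 − √35)/36`. -/
theorem rise_ge_of_wideSteer {u e z : EuclideanSpace ℝ (Fin 3)} (hu : ‖u‖ = 1) (he : ‖e‖ = 1) (hz : ‖z‖ = 1) (hze : ‖z - e‖ ≤ 1 / 3)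
    (hsteep : Real.sqrt 2 / 2 ≤ ⟪u, z⟫_ℝ) : Real.sqrt 2 * (17 - Real.sqrt 35) / 36 ≤ ⟪u, e⟫_ℝ :=
  (wideSteerable_iff hu he).1 ⟨z, hz, hze, hsteep⟩

end Summit.Ventures.Crystal3D.Theorems

end
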